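import Summits.NavierStokesRegularity.NavierStokesRegularity.Theorems.FilamentSkeletonRssKelvinGateRateLocking
import Summits.NavierStokesRegularity.NavierStokesRegularity.Theorems.FilamentSkeletonRssKelvinGatePerturbation

/-!
# Route `FilamentSkeletonRss` · crux `TransverseReductionRJ` (stmt-NavierStokesRegularity-21221) — line `kelvin_gate`,
# stub S2′ `EventualKelvinGate`: RATE LOCKING on the cube — interior zeros of a reduced family and the line's own output

Helper file (theorems only, `--supports stmt-NavierStokesRegularity-21221 --as helper`), continuing
`FilamentSkeletonRssKelvinGateRateLocking` in the crux's own vocabulary (the forced profile equation VERBATIM as in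
`AdmissibleJ` / `AlmostAdmissibleJ`, families on the unit cube, `GateSpec`, `GateSpec.perturb_core`).  HONEST FRAMING:
bookkeeping for a HYPOTHETICAL filament-type RSS blow-up route (refutation side); nothing here bears on Navier–Stokes
regularity; the stub is neither proved nor refuted.

## What is proved

* `eventually_line_mem_cube`, `family_deriv_eq_of_interior_zero` — along a line `t ↦ p + t e` through an INTERIOR cube
  point `p` with `B_p = 0`, a reduced family solving `E_(α_p)(U_p) + ∇P_p = Σ_j B_pj D_pj` on the cube and
  differentiable at `p` in the pointwise `C²` sense satisfies `𝓛_(α_p,U_p) V + G + (∂_e α) 𝓡₀U_p = Σ_j (∂_e B_j) D_pj`.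
* `abs_le_of_divFreeCokernel_pairing`, `one_le_rateGradient_divFree_core`, `false_of_rigidRate_divFree_core` — the
  cokernel bound and the two rate-locking conclusions on the DIVERGENCE-FREE range class (the functional need only
  annihilate `𝓛W + ∇Q` for divergence-free X-bounded `W`: the honest cokernel of the Stokes-type linearisation), on
  exactly the clause-(1) data of `GateSpec` / `GateSpec.perturb_core`.
* `GateSpec.false_of_rigidRate_output` / `GateSpec.one_le_rateGradient_output` — THE FORM THE LINE MEETS: a gate around
  the BASE family `U⁰` (stub S2′), a closed family `U = U⁰ + W` with `X(W_p) ≤ ν`, `8 C₂Γ^κ ν ≤ 1` (stub S3′ gives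
  `ν = 2 C₂ Cr Γ^(κ−k)`), solving the forced equation with multipliers `B`, an interior zero `p` of `B` (`BoxSelectionRJ`),
  an exact cokernel functional of the linearisation AT THE OUTPUT `U_p`, and `C¹`-in-`p` data at `p`: with constant rate
  and injective `DB(p)` this is `False`; with rate gradient `a` and `‖DB(p)⁻¹‖ ≤ M`,
  `1 ≤ N (M |ℓ(𝓡₀U_p)| Σ_i|a_i|) (2 C₂ Γ^κ)` (the gate is transported to the output by `GateSpec.perturb_core`).

## Reading (informal, for the planner; nothing below is used by the proofs)

At the Poincaré–Miranda zero `p⋆` of the closed family, `U⋆ = U_{p⋆}` is an exact unforced profile and `𝓡₀U⋆` an exact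
kernel vector of `𝓛 + ∇` (`lerayLin_rotField_add_gradient_rotScalar`, p596031).  IF the linearisation is Fredholm of
index `0` on the natural graph domain of the X/Y scales (the one analytic input not typed here) there is an exact
cokernel functional `ℓ ≠ 0`, and IF the closing is `C¹` in `p` at `p⋆` (true of any contraction-mapping construction from
`C¹` data; `BaseSpec`/`GateSpec` currently record only continuity), then:
(i) on a CONSTANT-RATE box (every pre-registered 21220 datum so far: `α ≡ 21/5`) a transversal zero is impossible —
    `DB(p⋆)` must be singular along the pairing vector `z`, and (manifold picture, informal) the local index of such a
    zero is `0`, so the Miranda degree `±1` of the face sign law cannot be realised by isolated zeros;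
(ii) on a box with varying rate the pairing `η_rot` of the obstruction ledger (evidence #25, (O1)) is SLAVED to the rate
    gradient, `η_rot ≤ M |ℓ(𝓡₀U⋆)| |∇_p α(p⋆)|` (normalised), and the gate needs `|∇_p α(p⋆)| ≳ Γ^{-κ}` up to the
    displayed constants: the selection box must SCAN THE RATE through the locked rate `α⋆` of the profile ("Tsai's
    cokernel direction" of the crux's why-it-might-fail line is a necessary box axis; cf. the R-β free-rate variant).
-/

set_option linter.dupNamespace false

noncomputable section

namespace Summit.NavierStokesRegularity.NavierStokesRegularity.Theorems.KelvinGate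

open Set Function Filter
open Literature.Analysis.FluidPDE
open scoped InnerProductSpace Laplacian ContDiff Topology BigOperators

/-! ## 0. The cokernel bound on the DIVERGENCE-FREE range class (sharper than `abs_le_of_cokernel_pairing`) -/

/-- **Cokernel bound, divergence-free class.**  As `abs_le_of_cokernel_pairing`, but (i) the inverting operators are
given with the divergence clause, exactly clause (1) of `GateSpec` at one parameter / the output of
`GateSpec.perturb_core`, and (ii) the functional `ℓ` need only vanish on `𝓛_(a₀,U) W + ∇Q` for DIVERGENCE-FREE X-bounded
`W` (the honest cokernel of the Stokes-type linearisation; a smaller demand on `ℓ`).  Conclusion unchanged: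
`|ℓ F| ≤ N · η · (C R)` whenever `|ℓ(Dm_j)| ≤ η` for all modes. -/
theorem abs_le_of_divFreeCokernel_pairing {N : ℕ} {a₀ C η : ℝ} {U : EuclideanSpace ℝ (Fin 3) → EuclideanSpace ℝ (Fin 3)}
    {Dm : Fin N → EuclideanSpace ℝ (Fin 3) → EuclideanSpace ℝ (Fin 3)}
    {K : (EuclideanSpace ℝ (Fin 3) → EuclideanSpace ℝ (Fin 3)) → EuclideanSpace ℝ (Fin 3) → EuclideanSpace ℝ (Fin 3)}
    {Qo : (EuclideanSpace ℝ (Fin 3) → EuclideanSpace ℝ (Fin 3)) → EuclideanSpace ℝ (Fin 3) → ℝ}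
    {Bo : (EuclideanSpace ℝ (Fin 3) → EuclideanSpace ℝ (Fin 3)) → Fin N → ℝ}
    (hK : ∀ (F : EuclideanSpace ℝ (Fin 3) → EuclideanSpace ℝ (Fin 3)) (R : ℝ), YBound F R →
      XBound (K F) (C * R) ∧ ContDiff ℝ 1 (Qo F) ∧ (∀ y, |Qo F y| ≤ C * R) ∧ (∀ j, |Bo F j| ≤ C * R) ∧
      VectorCalculus.IsDivFree (K F) ∧
      ∀ y, lerayLin a₀ U (K F) y + gradient (Qo F) y = F y + ∑ j, Bo F j • Dm j y)
    (ℓ : (EuclideanSpace ℝ (Fin 3) → EuclideanSpace ℝ (Fin 3)) →ₗ[ℝ] ℝ)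
    (hrange : ∀ (W : EuclideanSpace ℝ (Fin 3) → EuclideanSpace ℝ (Fin 3)) (Q : EuclideanSpace ℝ (Fin 3) → ℝ) (S : ℝ),
      XBound W S → VectorCalculus.IsDivFree W → ContDiff ℝ 1 Q → (∀ y, |Q y| ≤ S) →
      ℓ (fun y => lerayLin a₀ U W y + gradient Q y) = 0)
    (hη : ∀ j, |ℓ (Dm j)| ≤ η)
    (F : EuclideanSpace ℝ (Fin 3) → EuclideanSpace ℝ (Fin 3)) (R : ℝ) (hF : YBound F R) :
    |ℓ F| ≤ N * η * (C * R) := by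
  obtain ⟨hX, hQ1, hQ, hB, hdiv, heq⟩ := hK F R hF
  have hfun : (fun y => lerayLin a₀ U (K F) y + gradient (Qo F) y) =
      F + (∑ j, Bo F j • Dm j : EuclideanSpace ℝ (Fin 3) → EuclideanSpace ℝ (Fin 3)) := by
    funext y; simp only [heq y, Pi.add_apply, Finset.sum_apply, Pi.smul_apply]
  have key := hrange (K F) (Qo F) (C * R) hX hdiv hQ1 hQ
  rw [hfun, map_add, map_sum] at key
  simp only [map_smul, smul_eq_mul] at key
  have hF' : ℓ F = -∑ j, Bo F j * ℓ (Dm j) := by linarith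
  have hCR : 0 ≤ C * R := le_trans (abs_nonneg _) (hQ 0)
  calc |ℓ F| = |∑ j, Bo F j * ℓ (Dm j)| := by rw [hF', abs_neg]
    _ ≤ ∑ j, |Bo F j * ℓ (Dm j)| := Finset.abs_sum_le_sum_abs _ _
    _ ≤ ∑ _j : Fin N, (C * R) * η := Finset.sum_le_sum fun j _ => by
        rw [abs_mul]; exact mul_le_mul (hB j) (hη j) (abs_nonneg _) hCR
    _ = N * η * (C * R) := by
        simp only [Finset.sum_const, Finset.card_univ, Fintype.card_fin, nsmul_eq_mul]; ring

/-- **Rate locking, divergence-free core form.**  `one_le_rateGradient_core` on the divergence-free range class: the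
differentiated family `V_i` is assumed divergence-free (it is, as the `p`-derivative of divergence-free fields). -/
theorem one_le_rateGradient_divFree_core {N : ℕ} {a₀ C : ℝ} {U : EuclideanSpace ℝ (Fin 3) → EuclideanSpace ℝ (Fin 3)}
    {Dm : Fin N → EuclideanSpace ℝ (Fin 3) → EuclideanSpace ℝ (Fin 3)}
    {K : (EuclideanSpace ℝ (Fin 3) → EuclideanSpace ℝ (Fin 3)) → EuclideanSpace ℝ (Fin 3) → EuclideanSpace ℝ (Fin 3)}
    {Qo : (EuclideanSpace ℝ (Fin 3) → EuclideanSpace ℝ (Fin 3)) → EuclideanSpace ℝ (Fin 3) → ℝ}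
    {Bo : (EuclideanSpace ℝ (Fin 3) → EuclideanSpace ℝ (Fin 3)) → Fin N → ℝ}
    (hK : ∀ (F : EuclideanSpace ℝ (Fin 3) → EuclideanSpace ℝ (Fin 3)) (R : ℝ), YBound F R →
      XBound (K F) (C * R) ∧ ContDiff ℝ 1 (Qo F) ∧ (∀ y, |Qo F y| ≤ C * R) ∧ (∀ j, |Bo F j| ≤ C * R) ∧
      VectorCalculus.IsDivFree (K F) ∧
      ∀ y, lerayLin a₀ U (K F) y + gradient (Qo F) y = F y + ∑ j, Bo F j • Dm j y)
    (ℓ : (EuclideanSpace ℝ (Fin 3) → EuclideanSpace ℝ (Fin 3)) →ₗ[ℝ] ℝ)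
    (hrange : ∀ (W : EuclideanSpace ℝ (Fin 3) → EuclideanSpace ℝ (Fin 3)) (Q : EuclideanSpace ℝ (Fin 3) → ℝ) (S : ℝ),
      XBound W S → VectorCalculus.IsDivFree W → ContDiff ℝ 1 Q → (∀ y, |Q y| ≤ S) →
      ℓ (fun y => lerayLin a₀ U W y + gradient Q y) = 0)
    (F₀ : EuclideanSpace ℝ (Fin 3) → EuclideanSpace ℝ (Fin 3)) (hF₀ : YBound F₀ 1) (hdet : ℓ F₀ = 1)
    (R : EuclideanSpace ℝ (Fin 3) → EuclideanSpace ℝ (Fin 3))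
    (V : Fin N → EuclideanSpace ℝ (Fin 3) → EuclideanSpace ℝ (Fin 3)) (Q : Fin N → EuclideanSpace ℝ (Fin 3) → ℝ)
    (S : Fin N → ℝ) (J : Fin N → Fin N → ℝ) (a : Fin N → ℝ) (M : ℝ)
    (hV : ∀ i, XBound (V i) (S i)) (hVd : ∀ i, VectorCalculus.IsDivFree (V i)) (hQ : ∀ i, ContDiff ℝ 1 (Q i))
    (hQS : ∀ i y, |Q i y| ≤ S i)
    (hfam : ∀ i y, lerayLin a₀ U (V i) y + gradient (Q i) y + a i • R y = ∑ j, J i j • Dm j y)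
    (hJ : ∀ z c : Fin N → ℝ, (∀ i, ∑ j, J i j * z j = c i) → ∀ j, |z j| ≤ M * ∑ i, |c i|) :
    1 ≤ N * (M * |ℓ R| * ∑ i, |a i|) * C := by
  have hz : ∀ i, ∑ j, J i j * ℓ (Dm j) = a i * ℓ R := fun i =>
    pairing_identity ℓ (L := fun i y => lerayLin a₀ U (V i) y) (G := fun i y => gradient (Q i) y)
      hfam (fun i => hrange (V i) (Q i) (S i) (hV i) (hVd i) (hQ i) (hQS i)) i
  have hmodes : ∀ j, |ℓ (Dm j)| ≤ M * |ℓ R| * ∑ i, |a i| := by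
    intro j
    have := hJ (fun j => ℓ (Dm j)) (fun i => a i * ℓ R) hz j
    calc |ℓ (Dm j)| ≤ M * ∑ i, |a i * ℓ R| := this
      _ = M * |ℓ R| * ∑ i, |a i| := by
        have hs : ∑ i, |a i * ℓ R| = (∑ i, |a i|) * |ℓ R| := by
          rw [Finset.sum_mul]; exact Finset.sum_congr rfl fun i _ => abs_mul _ _
        rw [hs]; ring
  have key := abs_le_of_divFreeCokernel_pairing hK ℓ hrange hmodes F₀ 1 hF₀
  rwa [hdet, abs_one, mul_one] at key

/-- **Rate locking, divergence-free core rigid form**: constant rate (`a = 0`), `J` injective ⇒ `False`. -/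
theorem false_of_rigidRate_divFree_core {N : ℕ} {a₀ C : ℝ} {U : EuclideanSpace ℝ (Fin 3) → EuclideanSpace ℝ (Fin 3)}
    {Dm : Fin N → EuclideanSpace ℝ (Fin 3) → EuclideanSpace ℝ (Fin 3)}
    {K : (EuclideanSpace ℝ (Fin 3) → EuclideanSpace ℝ (Fin 3)) → EuclideanSpace ℝ (Fin 3) → EuclideanSpace ℝ (Fin 3)}
    {Qo : (EuclideanSpace ℝ (Fin 3) → EuclideanSpace ℝ (Fin 3)) → EuclideanSpace ℝ (Fin 3) → ℝ}
    {Bo : (EuclideanSpace ℝ (Fin 3) → EuclideanSpace ℝ (Fin 3)) → Fin N → ℝ}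
    (hK : ∀ (F : EuclideanSpace ℝ (Fin 3) → EuclideanSpace ℝ (Fin 3)) (R : ℝ), YBound F R →
      XBound (K F) (C * R) ∧ ContDiff ℝ 1 (Qo F) ∧ (∀ y, |Qo F y| ≤ C * R) ∧ (∀ j, |Bo F j| ≤ C * R) ∧
      VectorCalculus.IsDivFree (K F) ∧
      ∀ y, lerayLin a₀ U (K F) y + gradient (Qo F) y = F y + ∑ j, Bo F j • Dm j y)
    (ℓ : (EuclideanSpace ℝ (Fin 3) → EuclideanSpace ℝ (Fin 3)) →ₗ[ℝ] ℝ)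
    (hrange : ∀ (W : EuclideanSpace ℝ (Fin 3) → EuclideanSpace ℝ (Fin 3)) (Q : EuclideanSpace ℝ (Fin 3) → ℝ) (S : ℝ),
      XBound W S → VectorCalculus.IsDivFree W → ContDiff ℝ 1 Q → (∀ y, |Q y| ≤ S) →
      ℓ (fun y => lerayLin a₀ U W y + gradient Q y) = 0)
    (F₀ : EuclideanSpace ℝ (Fin 3) → EuclideanSpace ℝ (Fin 3)) (hF₀ : YBound F₀ 1) (hdet : ℓ F₀ = 1)
    (V : Fin N → EuclideanSpace ℝ (Fin 3) → EuclideanSpace ℝ (Fin 3)) (Q : Fin N → EuclideanSpace ℝ (Fin 3) → ℝ)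
    (S : Fin N → ℝ) (J : Fin N → Fin N → ℝ)
    (hV : ∀ i, XBound (V i) (S i)) (hVd : ∀ i, VectorCalculus.IsDivFree (V i)) (hQ : ∀ i, ContDiff ℝ 1 (Q i))
    (hQS : ∀ i y, |Q i y| ≤ S i)
    (hfam : ∀ i y, lerayLin a₀ U (V i) y + gradient (Q i) y = ∑ j, J i j • Dm j y)
    (hJ : ∀ z : Fin N → ℝ, (∀ i, ∑ j, J i j * z j = 0) → z = 0) : False := by
  have hmodes : ∀ j, |ℓ (Dm j)| ≤ 0 := fun j => le_of_eq (by
    rw [pairing_eq_zero_of_rigidRate ℓ (L := fun i y => lerayLin a₀ U (V i) y) (G := fun i y => gradient (Q i) y)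
      hfam (fun i => hrange (V i) (Q i) (S i) (hV i) (hVd i) (hQ i) (hQS i)) hJ j, abs_zero])
  have key := abs_le_of_divFreeCokernel_pairing hK ℓ hrange hmodes F₀ 1 hF₀
  rw [hdet, abs_one] at key
  linarith

/-! ## 1. Interior zeros of a reduced family on the cube -/

/-- Near `t = 0` the line `t ↦ p + t • e` through an INTERIOR point `p` of the unit cube stays in the closed cube. -/
theorem eventually_line_mem_cube {N : ℕ} {p : Fin N → ℝ} (e : Fin N → ℝ) (hp : ∀ i, p i ∈ Ioo (0:ℝ) 1) :
    ∀ᶠ t in 𝓝 (0:ℝ), ∀ i, (p + t • e) i ∈ Icc (0:ℝ) 1 := by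
  rw [Filter.eventually_all]
  intro i
  have hc : Continuous fun t : ℝ => (p + t • e) i := by
    simp only [Pi.add_apply, Pi.smul_apply, smul_eq_mul]
    exact continuous_const.add (continuous_id.mul continuous_const)
  have h0 : (fun t : ℝ => (p + t • e) i) 0 ∈ Ioo (0:ℝ) 1 := by simpa using hp i
  exact (hc.continuousAt.eventually_mem (Ioo_mem_nhds h0.1 h0.2)).mono fun t ht => Ioo_subset_Icc_self ht

/-- **Rate locking on the cube, differentiated equation.**  Let `(U_p, P_p, B_p)` solve the crux's forced profile
equation `E_(α_p)(U_p) + ∇P_p = Σ_j B_pj D_pj` at every `p` of the unit cube (the equation clause of `AdmissibleJ` /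
`AlmostAdmissibleJ`, VERBATIM), let `p` be an INTERIOR point with `B_p = 0` (the Poincaré–Miranda zero of
`BoxSelectionRJ` is interior by the strict face sign law), and let `e` be a direction along which, at the point `y`,
the rate, the field with its first two derivatives, the pressure gradient and the multipliers are differentiable at `p`
(derivatives `a`, `V y`, `DV(y)`, `ΔV(y)`, `G y`, `B'`) and the modes are continuous.  Then
`𝓛_(α_p,U_p) V(y) + G(y) + a • 𝓡₀U_p(y) = Σ_j B'_j • D_pj(y)`. -/
theorem family_deriv_eq_of_interior_zero {N : ℕ} {α : (Fin N → ℝ) → ℝ}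
    {D : (Fin N → ℝ) → Fin N → EuclideanSpace ℝ (Fin 3) → EuclideanSpace ℝ (Fin 3)}
    {U : (Fin N → ℝ) → EuclideanSpace ℝ (Fin 3) → EuclideanSpace ℝ (Fin 3)} {P : (Fin N → ℝ) → EuclideanSpace ℝ (Fin 3) → ℝ}
    {B : (Fin N → ℝ) → Fin N → ℝ}
    (heq : ∀ p : Fin N → ℝ, (∀ i, p i ∈ Icc (0:ℝ) 1) → ∀ y, α p•(cross (EuclideanSpace.single 2 1) (U p y)-fderiv ℝ (U p) y (cross (EuclideanSpace.single 2 1) y))+(1/2:ℝ)•U p y+(1/2:ℝ)•fderiv ℝ (U p) y y-(Laplacian.laplacian (U p)) y+fderiv ℝ (U p) y (U p y)+gradient (P p) y = ∑ j, B p j•D p j y)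
    {p : Fin N → ℝ} (hp : ∀ i, p i ∈ Ioo (0:ℝ) 1) (hB0 : B p = 0) (e : Fin N → ℝ) {a : ℝ}
    {V G : EuclideanSpace ℝ (Fin 3) → EuclideanSpace ℝ (Fin 3)} {B' : Fin N → ℝ} (y : EuclideanSpace ℝ (Fin 3))
    (hα : HasDerivAt (fun t : ℝ => α (p + t • e)) a 0)
    (hU : HasDerivAt (fun t : ℝ => U (p + t • e) y) (V y) 0)
    (hDU : HasDerivAt (fun t : ℝ => fderiv ℝ (U (p + t • e)) y) (fderiv ℝ V y) 0)
    (hΔ : HasDerivAt (fun t : ℝ => (Δ (U (p + t • e))) y) ((Δ V) y) 0)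
    (hP : HasDerivAt (fun t : ℝ => gradient (P (p + t • e)) y) (G y) 0)
    (hB : ∀ j, HasDerivAt (fun t : ℝ => B (p + t • e) j) (B' j) 0)
    (hDc : ∀ j, ContinuousAt (fun t : ℝ => D (p + t • e) j y) 0) :
    lerayLin (α p) (U p) V y + G y +
        a • (cross (EuclideanSpace.single 2 1) (U p y) - fderiv ℝ (U p) y (cross (EuclideanSpace.single 2 1) y)) =
      ∑ j, B' j • D p j y := by
  have heq' : ∀ᶠ t in 𝓝 (0:ℝ), lerayOp (α (p + t • e)) (U (p + t • e)) y + gradient (P (p + t • e)) y =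
      ∑ j, B (p + t • e) j • D (p + t • e) j y :=
    (eventually_line_mem_cube e hp).mono fun t ht => heq (p + t • e) ht y
  have hB0' : (fun t : ℝ => B (p + t • e)) 0 = 0 := by
    show B (p + (0:ℝ) • e) = 0
    rw [zero_smul, add_zero, hB0]
  have key := lerayLin_family_deriv_eq_of_zero (α := fun t => α (p + t • e)) (U := fun t => U (p + t • e))
    (P := fun t => P (p + t • e)) (B := fun t => B (p + t • e)) (D := fun t => D (p + t • e))
    y heq' hB0' hα hU hDU hΔ hP hB hDc
  simpa only [zero_smul, add_zero] using key

/-! ## 2. The line's own output: gate around the base, closed family `U = U⁰ + W`, zero of `B` -/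

/-- **Rate locking at the line's own output (rigid form).**  Data: a Kelvin gate `(𝓚, 𝓠, 𝓑)` with constants `(κ, C₂)`
around a base family `U⁰` of differentiable fields (stub S2′ around the stub-S1 base); a closed family `U_p = U⁰_p + W_p`
with `X(W_p) ≤ ν` on the cube and `8 C₂Γ^κ ν ≤ 1` (stub S3′), solving with pressures `P` and multipliers `B` the crux's
forced profile equation on the cube; an INTERIOR zero `p` of `B` (`BoxSelectionRJ`); a linear functional `ℓ` vanishing
on the range class of the linearisation AT THE OUTPUT, `ℓ(𝓛_(α_p,U_p)W' + ∇Q) = 0` for X-bounded `W'` and bounded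
`C¹` `Q`, and detecting one unit forcing; along `N` directions `e_i`: zero rate derivative (constant-rate box), pointwise
`C²` differentiability of the family at `p` with X-bounded velocity derivatives `V_i` and bounded `C¹` pressure
derivatives `Q_i`, differentiable multipliers with INJECTIVE Jacobian `J i j = ∂_{e_i}B_j(p)`, modes continuous in the
parameter.  Conclusion: `False`.  (The gate is moved to the output by `GateSpec.perturb_core`, then
`false_of_rigidRate_core` applies with the differentiated equation `family_deriv_eq_of_interior_zero`.) -/
theorem GateSpec.false_of_rigidRate_output {N : ℕ} {Γ κ C₂ : ℝ} {α : (Fin N → ℝ) → ℝ}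
    {D : (Fin N → ℝ) → Fin N → EuclideanSpace ℝ (Fin 3) → EuclideanSpace ℝ (Fin 3)}
    {U0 : (Fin N → ℝ) → EuclideanSpace ℝ (Fin 3) → EuclideanSpace ℝ (Fin 3)}
    {𝓚 : (Fin N → ℝ) → (EuclideanSpace ℝ (Fin 3) → EuclideanSpace ℝ (Fin 3)) → EuclideanSpace ℝ (Fin 3) → EuclideanSpace ℝ (Fin 3)}
    {𝓠 : (Fin N → ℝ) → (EuclideanSpace ℝ (Fin 3) → EuclideanSpace ℝ (Fin 3)) → EuclideanSpace ℝ (Fin 3) → ℝ}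
    {𝓑 : (Fin N → ℝ) → (EuclideanSpace ℝ (Fin 3) → EuclideanSpace ℝ (Fin 3)) → Fin N → ℝ}
    (hgate : GateSpec N Γ κ C₂ α D U0 𝓚 𝓠 𝓑)
    (hU0 : ∀ q : Fin N → ℝ, (∀ i, q i ∈ Icc (0:ℝ) 1) → Differentiable ℝ (U0 q))
    {W : (Fin N → ℝ) → EuclideanSpace ℝ (Fin 3) → EuclideanSpace ℝ (Fin 3)} {ν : ℝ}
    (hW : ∀ q : Fin N → ℝ, (∀ i, q i ∈ Icc (0:ℝ) 1) → XBound (W q) ν) (hν : 8 * (C₂ * Γ ^ κ) * ν ≤ 1)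
    {U : (Fin N → ℝ) → EuclideanSpace ℝ (Fin 3) → EuclideanSpace ℝ (Fin 3)} {P : (Fin N → ℝ) → EuclideanSpace ℝ (Fin 3) → ℝ}
    {B : (Fin N → ℝ) → Fin N → ℝ} (hUW : ∀ q y, U q y = U0 q y + W q y)
    (heq : ∀ p : Fin N → ℝ, (∀ i, p i ∈ Icc (0:ℝ) 1) → ∀ y, α p•(cross (EuclideanSpace.single 2 1) (U p y)-fderiv ℝ (U p) y (cross (EuclideanSpace.single 2 1) y))+(1/2:ℝ)•U p y+(1/2:ℝ)•fderiv ℝ (U p) y y-(Laplacian.laplacian (U p)) y+fderiv ℝ (U p) y (U p y)+gradient (P p) y = ∑ j, B p j•D p j y)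
    {p : Fin N → ℝ} (hp : ∀ i, p i ∈ Ioo (0:ℝ) 1) (hB0 : B p = 0)
    (ℓ : (EuclideanSpace ℝ (Fin 3) → EuclideanSpace ℝ (Fin 3)) →ₗ[ℝ] ℝ)
    (hrange : ∀ (W' : EuclideanSpace ℝ (Fin 3) → EuclideanSpace ℝ (Fin 3)) (Q : EuclideanSpace ℝ (Fin 3) → ℝ) (S : ℝ),
      XBound W' S → VectorCalculus.IsDivFree W' → ContDiff ℝ 1 Q → (∀ y, |Q y| ≤ S) →
      ℓ (fun y => lerayLin (α p) (U p) W' y + gradient Q y) = 0)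
    (F₀ : EuclideanSpace ℝ (Fin 3) → EuclideanSpace ℝ (Fin 3)) (hF₀ : YBound F₀ 1) (hdet : ℓ F₀ = 1)
    (e : Fin N → Fin N → ℝ) (V : Fin N → EuclideanSpace ℝ (Fin 3) → EuclideanSpace ℝ (Fin 3))
    (Q : Fin N → EuclideanSpace ℝ (Fin 3) → ℝ) (S : Fin N → ℝ) (J : Fin N → Fin N → ℝ)
    (hα : ∀ i, HasDerivAt (fun t : ℝ => α (p + t • e i)) 0 0)
    (hU : ∀ i y, HasDerivAt (fun t : ℝ => U (p + t • e i) y) (V i y) 0)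
    (hDU : ∀ i y, HasDerivAt (fun t : ℝ => fderiv ℝ (U (p + t • e i)) y) (fderiv ℝ (V i) y) 0)
    (hΔ : ∀ i y, HasDerivAt (fun t : ℝ => (Δ (U (p + t • e i))) y) ((Δ (V i)) y) 0)
    (hP : ∀ i y, HasDerivAt (fun t : ℝ => gradient (P (p + t • e i)) y) (gradient (Q i) y) 0)
    (hB : ∀ i j, HasDerivAt (fun t : ℝ => B (p + t • e i) j) (J i j) 0)
    (hDc : ∀ i j y, ContinuousAt (fun t : ℝ => D (p + t • e i) j y) 0)
    (hV : ∀ i, XBound (V i) (S i)) (hVd : ∀ i, VectorCalculus.IsDivFree (V i)) (hQ : ∀ i, ContDiff ℝ 1 (Q i))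
    (hQS : ∀ i y, |Q i y| ≤ S i)
    (hJ : ∀ z : Fin N → ℝ, (∀ i, ∑ j, J i j * z j = 0) → z = 0) : False := by
  have hp' : ∀ i, p i ∈ Icc (0:ℝ) 1 := fun i => Ioo_subset_Icc_self (hp i)
  obtain ⟨𝓚', 𝓠', 𝓑', h'⟩ := hgate.perturb_core hU0 hW hν
  have hUp : (fun z => U0 p z + W p z) = U p := funext fun z => (hUW p z).symm
  have hK : ∀ (F : EuclideanSpace ℝ (Fin 3) → EuclideanSpace ℝ (Fin 3)) (R : ℝ), YBound F R →
      XBound (𝓚' p F) (2 * C₂ * Γ ^ κ * R) ∧ ContDiff ℝ 1 (𝓠' p F) ∧ (∀ y, |𝓠' p F y| ≤ 2 * C₂ * Γ ^ κ * R) ∧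
      (∀ j, |𝓑' p F j| ≤ 2 * C₂ * Γ ^ κ * R) ∧ VectorCalculus.IsDivFree (𝓚' p F) ∧
      ∀ y, lerayLin (α p) (U p) (𝓚' p F) y + gradient (𝓠' p F) y = F y + ∑ j, 𝓑' p F j • D p j y := by
    intro F R hF
    obtain ⟨hX, hQ1, hQb, hBb, hd, he⟩ := (h' p hp').1 F R hF
    rw [hUp] at he
    exact ⟨hX, hQ1, hQb, hBb, hd, he⟩
  refine false_of_rigidRate_divFree_core hK ℓ hrange F₀ hF₀ hdet V Q S J hV hVd hQ hQS (fun i y => ?_) hJ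
  have key := family_deriv_eq_of_interior_zero heq hp hB0 (e i) y (hα i) (hU i y) (hDU i y) (hΔ i y) (hP i y)
    (hB i) (fun j => hDc i j y)
  rwa [zero_smul, add_zero] at key

/-- **Rate locking at the line's own output (quantitative form).**  As `GateSpec.false_of_rigidRate_output`, with rate
derivatives `a_i = ∂_{e_i}α(p)` and a multiplier Jacobian whose inverse is bounded by `M` (`J z = c ⇒ |z_j| ≤ M Σ_i|c_i|`):
`1 ≤ N · (M · |ℓ(𝓡₀U_p)| · Σ_i |a_i|) · (2 C₂ Γ^κ)`, `𝓡₀U_p(y) = e₃ × U_p(y) − DU_p(y)[e₃ × y]` the rotation kernel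
direction at the output profile.  The selected zero must sit where the rate MOVES across the box, at speed at least
`(2 N M |ℓ(𝓡₀U_p)| C₂ Γ^κ)⁻¹` in ℓ¹ norm. -/
theorem GateSpec.one_le_rateGradient_output {N : ℕ} {Γ κ C₂ : ℝ} {α : (Fin N → ℝ) → ℝ}
    {D : (Fin N → ℝ) → Fin N → EuclideanSpace ℝ (Fin 3) → EuclideanSpace ℝ (Fin 3)}
    {U0 : (Fin N → ℝ) → EuclideanSpace ℝ (Fin 3) → EuclideanSpace ℝ (Fin 3)}
    {𝓚 : (Fin N → ℝ) → (EuclideanSpace ℝ (Fin 3) → EuclideanSpace ℝ (Fin 3)) → EuclideanSpace ℝ (Fin 3) → EuclideanSpace ℝ (Fin 3)}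
    {𝓠 : (Fin N → ℝ) → (EuclideanSpace ℝ (Fin 3) → EuclideanSpace ℝ (Fin 3)) → EuclideanSpace ℝ (Fin 3) → ℝ}
    {𝓑 : (Fin N → ℝ) → (EuclideanSpace ℝ (Fin 3) → EuclideanSpace ℝ (Fin 3)) → Fin N → ℝ}
    (hgate : GateSpec N Γ κ C₂ α D U0 𝓚 𝓠 𝓑)
    (hU0 : ∀ q : Fin N → ℝ, (∀ i, q i ∈ Icc (0:ℝ) 1) → Differentiable ℝ (U0 q))
    {W : (Fin N → ℝ) → EuclideanSpace ℝ (Fin 3) → EuclideanSpace ℝ (Fin 3)} {ν : ℝ}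
    (hW : ∀ q : Fin N → ℝ, (∀ i, q i ∈ Icc (0:ℝ) 1) → XBound (W q) ν) (hν : 8 * (C₂ * Γ ^ κ) * ν ≤ 1)
    {U : (Fin N → ℝ) → EuclideanSpace ℝ (Fin 3) → EuclideanSpace ℝ (Fin 3)} {P : (Fin N → ℝ) → EuclideanSpace ℝ (Fin 3) → ℝ}
    {B : (Fin N → ℝ) → Fin N → ℝ} (hUW : ∀ q y, U q y = U0 q y + W q y)
    (heq : ∀ p : Fin N → ℝ, (∀ i, p i ∈ Icc (0:ℝ) 1) → ∀ y, α p•(cross (EuclideanSpace.single 2 1) (U p y)-fderiv ℝ (U p) y (cross (EuclideanSpace.single 2 1) y))+(1/2:ℝ)•U p y+(1/2:ℝ)•fderiv ℝ (U p) y y-(Laplacian.laplacian (U p)) y+fderiv ℝ (U p) y (U p y)+gradient (P p) y = ∑ j, B p j•D p j y)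
    {p : Fin N → ℝ} (hp : ∀ i, p i ∈ Ioo (0:ℝ) 1) (hB0 : B p = 0)
    (ℓ : (EuclideanSpace ℝ (Fin 3) → EuclideanSpace ℝ (Fin 3)) →ₗ[ℝ] ℝ)
    (hrange : ∀ (W' : EuclideanSpace ℝ (Fin 3) → EuclideanSpace ℝ (Fin 3)) (Q : EuclideanSpace ℝ (Fin 3) → ℝ) (S : ℝ),
      XBound W' S → VectorCalculus.IsDivFree W' → ContDiff ℝ 1 Q → (∀ y, |Q y| ≤ S) →
      ℓ (fun y => lerayLin (α p) (U p) W' y + gradient Q y) = 0)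
    (F₀ : EuclideanSpace ℝ (Fin 3) → EuclideanSpace ℝ (Fin 3)) (hF₀ : YBound F₀ 1) (hdet : ℓ F₀ = 1)
    (e : Fin N → Fin N → ℝ) (V : Fin N → EuclideanSpace ℝ (Fin 3) → EuclideanSpace ℝ (Fin 3))
    (Q : Fin N → EuclideanSpace ℝ (Fin 3) → ℝ) (S : Fin N → ℝ) (J : Fin N → Fin N → ℝ) (a : Fin N → ℝ) (M : ℝ)
    (hα : ∀ i, HasDerivAt (fun t : ℝ => α (p + t • e i)) (a i) 0)
    (hU : ∀ i y, HasDerivAt (fun t : ℝ => U (p + t • e i) y) (V i y) 0)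
    (hDU : ∀ i y, HasDerivAt (fun t : ℝ => fderiv ℝ (U (p + t • e i)) y) (fderiv ℝ (V i) y) 0)
    (hΔ : ∀ i y, HasDerivAt (fun t : ℝ => (Δ (U (p + t • e i))) y) ((Δ (V i)) y) 0)
    (hP : ∀ i y, HasDerivAt (fun t : ℝ => gradient (P (p + t • e i)) y) (gradient (Q i) y) 0)
    (hB : ∀ i j, HasDerivAt (fun t : ℝ => B (p + t • e i) j) (J i j) 0)
    (hDc : ∀ i j y, ContinuousAt (fun t : ℝ => D (p + t • e i) j y) 0)
    (hV : ∀ i, XBound (V i) (S i)) (hVd : ∀ i, VectorCalculus.IsDivFree (V i)) (hQ : ∀ i, ContDiff ℝ 1 (Q i))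
    (hQS : ∀ i y, |Q i y| ≤ S i)
    (hJ : ∀ z c : Fin N → ℝ, (∀ i, ∑ j, J i j * z j = c i) → ∀ j, |z j| ≤ M * ∑ i, |c i|) :
    1 ≤ N * (M * |ℓ (fun y => cross (EuclideanSpace.single 2 1) (U p y) -
        fderiv ℝ (U p) y (cross (EuclideanSpace.single 2 1) y))| * ∑ i, |a i|) * (2 * C₂ * Γ ^ κ) := by
  have hp' : ∀ i, p i ∈ Icc (0:ℝ) 1 := fun i => Ioo_subset_Icc_self (hp i)
  obtain ⟨𝓚', 𝓠', 𝓑', h'⟩ := hgate.perturb_core hU0 hW hν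
  have hUp : (fun z => U0 p z + W p z) = U p := funext fun z => (hUW p z).symm
  have hK : ∀ (F : EuclideanSpace ℝ (Fin 3) → EuclideanSpace ℝ (Fin 3)) (R : ℝ), YBound F R →
      XBound (𝓚' p F) (2 * C₂ * Γ ^ κ * R) ∧ ContDiff ℝ 1 (𝓠' p F) ∧ (∀ y, |𝓠' p F y| ≤ 2 * C₂ * Γ ^ κ * R) ∧
      (∀ j, |𝓑' p F j| ≤ 2 * C₂ * Γ ^ κ * R) ∧ VectorCalculus.IsDivFree (𝓚' p F) ∧
      ∀ y, lerayLin (α p) (U p) (𝓚' p F) y + gradient (𝓠' p F) y = F y + ∑ j, 𝓑' p F j • D p j y := by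
    intro F R hF
    obtain ⟨hX, hQ1, hQb, hBb, hd, he⟩ := (h' p hp').1 F R hF
    rw [hUp] at he
    exact ⟨hX, hQ1, hQb, hBb, hd, he⟩
  refine one_le_rateGradient_divFree_core hK ℓ hrange F₀ hF₀ hdet _ V Q S J a M hV hVd hQ hQS (fun i y => ?_) hJ
  exact family_deriv_eq_of_interior_zero heq hp hB0 (e i) y (hα i) (hU i y) (hDU i y) (hΔ i y) (hP i y)
    (hB i) (fun j => hDc i j y)

end Summit.NavierStokesRegularity.NavierStokesRegularity.Theorems.KelvinGate
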